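import Literature.NumberTheory.LFunctions.PolynomialRootMertensFirst
import Literature.NumberTheory.Sieve.PolynomialCongruencesRootDensity
import HarnessLib

/-!
# Chebyshev and Mertens estimates for the roots of an irreducible polynomial
# (any leading coefficient)

Topic `Literature/NumberTheory/LFunctions` (sequel to `DegreeOnePrimesPNT.lean`,
`PolynomialRootMertensFirst.lean`). Everything here is PROVED; no definitions, no named facts.

For `g ∈ ℤ[X]` irreducible of positive degree and `ρ_g(p) = #{n mod p : g(n) ≡ 0}`
(`polyRootCountMod ![g] p`):

* `abs_thetaRoot_sub_self_le` — the prime ideal theorem along `g` with log-square saving for ANY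
  leading coefficient: `|∑_{p ≤ t} ρ_g(p) log p − t| ≤ C t/log² t` (`t ≥ 2`) (the tree's monic
  `DegreeOnePrimes.abs_sum_primesLE_rootCount_mul_log_sub_self_le_logPow` transported through the
  monic integral normalization, `polyRootCountMod_integralNormalization`: the two root counts differ
  at the finitely many primes dividing `lc g`);
* `abs_sum_primesLE_rootCount_div_sub_loglog_le` — Mertens' second theorem along `g` with rate:
  `|∑_{p ≤ t} ρ_g(p)/p − (log log t + b_g)| ≤ C/log² t` (`t ≥ 2`)
  (`ThetaMertens.sum_primesLE_div_of_theta`);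
* `thetaRoot_le` — Chebyshev's bound along `g`: `∑_{p ≤ t} ρ_g(p) log p ≤ C t` (`t ≥ 0`);
* `sum_moebius_sq_rootCount_div_le` — `∑_{m ≤ V} μ²(m)ρ_g(m)/m ≤ K(1 + log V)`
  (`≤ ∏_{p ≤ V}(1 + ρ_g(p)/p) ≤ exp(∑_{p ≤ V} ρ_g(p)/p)`).

These are the prime-sum inputs of the friable Möbius–root sum asymptotics
(`Literature/NumberTheory/Sieve/FriableMoebiusRootSum*.lean`).

## References

* E. Landau, *Neuer Beweis des Primzahlsatzes und Beweis des Primidealsatzes*, Math. Ann. 56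
  (1903), 645–670, §13. [LandauMathAnn1903]
* H. L. Montgomery, R. C. Vaughan, *Multiplicative Number Theory I*, CUP 2007, §2.2–2.3
  (Chebyshev, Mertens by partial summation). [MontgomeryVaughan2007]
-/

noncomputable section

open Finset Real Polynomial

namespace Literature.NumberTheory.LFunctions.DegreeOnePrimes

open Literature.NumberTheory.Sieve

/-- Monic case of `abs_thetaRoot_sub_self_le`, in the `polyRootCountMod` currency: for `g ∈ ℤ[X]`
monic irreducible there is `C ≥ 0` with `|∑_{p ≤ t} ρ_g(p) log p − t| ≤ C t/log² t` for all real
`t ≥ 2` (the tree's `abs_sum_primesLE_rootCount_mul_log_sub_self_le_logPow` with `A = 2`).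
[cite: LandauMathAnn1903, §13 p. 669] -/
theorem abs_thetaRoot_sub_self_le_of_monic {g : ℤ[X]} (hg : g.Monic) (hirr : Irreducible g) :
    ∃ C : ℝ, 0 ≤ C ∧ ∀ t : ℝ, 2 ≤ t →
      |∑ p ∈ Nat.primesLE ⌊t⌋₊, (polyRootCountMod ![g] p : ℝ) * Real.log p - t| ≤
        C * t / Real.log t ^ 2 := by
  obtain ⟨C, hC⟩ := abs_sum_primesLE_rootCount_mul_log_sub_self_le_logPow hg hirr 2
  refine ⟨|C|, abs_nonneg C, fun t ht => ?_⟩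
  have h := hC t ht
  rw [Real.rpow_two] at h
  have ht0 : (0 : ℝ) ≤ t := by linarith
  have hle : C * t / Real.log t ^ 2 ≤ |C| * t / Real.log t ^ 2 :=
    div_le_div_of_nonneg_right (mul_le_mul_of_nonneg_right (le_abs_self C) ht0)
      (pow_nonneg (Real.log_nonneg (by linarith)) 2)
  refine le_trans ?_ hle
  simpa only [polyRootCountMod_single] using h

/-- **Prime ideal theorem along `g`, log-square saving, any leading coefficient**: for `g ∈ ℤ[X]`
irreducible with `0 < deg g` there is `C ≥ 0` with `|∑_{p ≤ t} ρ_g(p) log p − t| ≤ C t/log² t`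
for all real `t ≥ 2`. [cite: LandauMathAnn1903, §13 p. 669] -/
theorem abs_thetaRoot_sub_self_le {g : ℤ[X]} (hirr : Irreducible g) (hdeg : 0 < g.natDegree) :
    ∃ C : ℝ, 0 ≤ C ∧ ∀ t : ℝ, 2 ≤ t →
      |∑ p ∈ Nat.primesLE ⌊t⌋₊, (polyRootCountMod ![g] p : ℝ) * Real.log p - t| ≤
        C * t / Real.log t ^ 2 := by
  set g₁ : ℤ[X] := integralNormalization g with hg₁
  obtain ⟨C, hC0, hC⟩ := abs_thetaRoot_sub_self_le_of_monic
    (monic_integralNormalization hirr.ne_zero) (irreducible_integralNormalization hirr hdeg)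
  set N : ℕ := g.leadingCoeff.natAbs with hN
  set E : ℝ := ∑ p ∈ Nat.primesLE N, (p : ℝ) * Real.log p with hE
  set ρ : ℕ → ℝ := fun p => (polyRootCountMod ![g] p : ℝ) with hρ
  set ρ₁ : ℕ → ℝ := fun p => (polyRootCountMod ![g₁] p : ℝ) with hρ₁
  have hlc : g.leadingCoeff ≠ 0 := leadingCoeff_ne_zero.mpr hirr.ne_zero
  have hE0 : 0 ≤ E :=
    sum_nonneg fun p _ => mul_nonneg (Nat.cast_nonneg p) (Real.log_natCast_nonneg p)
  -- at a prime `p ∤ lc g` the two root counts agree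
  have hagree : ∀ p : ℕ, p.Prime → ¬ p ∣ N → ρ p = ρ₁ p := by
    intro p hp hpN
    simp only [hρ, hρ₁, hg₁]
    rw [polyRootCountMod_integralNormalization hdeg hp]
    intro hdvd
    exact hpN (Int.natCast_dvd.mp hdvd)
  -- at every prime the difference of the terms is at most `p log p`
  have hterm : ∀ p : ℕ, p.Prime →
      |ρ p * Real.log p - ρ₁ p * Real.log p| ≤ (p : ℝ) * Real.log p := by
    intro p hp
    have hlog : 0 ≤ Real.log p := Real.log_natCast_nonneg p
    have h0 : 0 ≤ ρ p := Nat.cast_nonneg _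
    have h1 : 0 ≤ ρ₁ p := Nat.cast_nonneg _
    have h2 : ρ p ≤ p := by
      simp only [hρ]
      exact_mod_cast polyRootCountMod_le ![g] p
    have h3 : ρ₁ p ≤ p := by
      simp only [hρ₁]
      exact_mod_cast polyRootCountMod_le ![g₁] p
    have hd : |ρ p - ρ₁ p| ≤ p := by
      rw [abs_le]
      constructor <;> linarith
    rw [← sub_mul, abs_mul, abs_of_nonneg hlog]
    exact mul_le_mul_of_nonneg_right hd hlog
  -- the difference of the two sums is supported on the primes dividing `lc g`
  have hdiff : ∀ Q : ℕ, |(∑ p ∈ Nat.primesLE Q, ρ p * Real.log p) -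
      ∑ p ∈ Nat.primesLE Q, ρ₁ p * Real.log p| ≤ E := by
    intro Q
    rw [← sum_sub_distrib]
    have h1 : ∑ p ∈ Nat.primesLE Q, (ρ p * Real.log p - ρ₁ p * Real.log p) =
        ∑ p ∈ (Nat.primesLE Q).filter (fun p => p ∣ N),
          (ρ p * Real.log p - ρ₁ p * Real.log p) := by
      rw [sum_filter_of_ne]
      intro p hp hne
      by_contra hpN
      exact hne (by rw [hagree p (Nat.prime_of_mem_primesLE hp) hpN, sub_self])
    rw [h1]
    calc |∑ p ∈ (Nat.primesLE Q).filter (fun p => p ∣ N), (ρ p * Real.log p - ρ₁ p * Real.log p)|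
        ≤ ∑ p ∈ (Nat.primesLE Q).filter (fun p => p ∣ N),
            |ρ p * Real.log p - ρ₁ p * Real.log p| := abs_sum_le_sum_abs _ _
      _ ≤ ∑ p ∈ (Nat.primesLE Q).filter (fun p => p ∣ N), (p : ℝ) * Real.log p :=
          sum_le_sum fun p hp => hterm p (Nat.prime_of_mem_primesLE (mem_filter.mp hp).1)
      _ ≤ E := by
          refine sum_le_sum_of_subset_of_nonneg (fun p hp => ?_)
            fun p _ _ => mul_nonneg (Nat.cast_nonneg p) (Real.log_natCast_nonneg p)
          obtain ⟨hp, hpN⟩ := mem_filter.mp hp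
          exact Nat.mem_primesLE.mpr
            ⟨Nat.le_of_dvd (Int.natAbs_pos.mpr hlc) hpN, Nat.prime_of_mem_primesLE hp⟩
  refine ⟨C + 2 * E, by linarith, fun t ht => ?_⟩
  have hmain := hC t ht
  have hd := hdiff ⌊t⌋₊
  have hlogpos : 0 < Real.log t := Real.log_pos (by linarith)
  -- `log² t ≤ 2t`, so the constant `E` is absorbed into `2E · t/log² t`
  have hlog2 : Real.log t ^ 2 ≤ 2 * t := by
    have h := Real.quadratic_le_exp_of_nonneg hlogpos.le
    rw [Real.exp_log (by linarith)] at h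
    nlinarith
  have hEt : E ≤ 2 * E * t / Real.log t ^ 2 := by
    rw [le_div_iff₀ (by positivity)]
    nlinarith [mul_le_mul_of_nonneg_left hlog2 hE0]
  calc |∑ p ∈ Nat.primesLE ⌊t⌋₊, ρ p * Real.log p - t|
      ≤ |(∑ p ∈ Nat.primesLE ⌊t⌋₊, ρ p * Real.log p) -
          ∑ p ∈ Nat.primesLE ⌊t⌋₊, ρ₁ p * Real.log p| +
        |∑ p ∈ Nat.primesLE ⌊t⌋₊, ρ₁ p * Real.log p - t| := abs_sub_le _ _ _
    _ ≤ E + C * t / Real.log t ^ 2 := add_le_add hd hmain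
    _ ≤ 2 * E * t / Real.log t ^ 2 + C * t / Real.log t ^ 2 := by linarith
    _ = (C + 2 * E) * t / Real.log t ^ 2 := by ring

/-- **Mertens' second theorem along `g` with rate**: for `g ∈ ℤ[X]` irreducible with
`0 < deg g` there are `b` and `C` with `|∑_{p ≤ t} ρ_g(p)/p − (log log t + b)| ≤ C/log² t` for
all real `t ≥ 2`. [cite: LandauMathAnn1903, §13 p. 669] -/
theorem abs_sum_primesLE_rootCount_div_sub_loglog_le {g : ℤ[X]} (hirr : Irreducible g)
    (hdeg : 0 < g.natDegree) :
    ∃ b C : ℝ, ∀ t : ℝ, 2 ≤ t →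
      |∑ p ∈ Nat.primesLE ⌊t⌋₊, (polyRootCountMod ![g] p : ℝ) / p - (Real.log (Real.log t) + b)| ≤
        C / Real.log t ^ 2 := by
  obtain ⟨C, -, hC⟩ := abs_thetaRoot_sub_self_le hirr hdeg
  have hθ : ∀ t : ℝ, 2 ≤ t →
      |∑ p ∈ Nat.primesLE ⌊t⌋₊, (polyRootCountMod ![g] p : ℝ) * Real.log p - 1 * t| ≤
        C * t / Real.log t ^ (1 + 1) := by
    intro t ht
    simpa only [one_mul, Nat.reduceAdd] using hC t ht
  obtain ⟨c, K, h⟩ := ThetaMertens.sum_primesLE_div_of_theta hθ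
  exact ⟨c, K, fun t ht => by simpa only [one_mul, Nat.reduceAdd] using h t ht⟩

/-- **Chebyshev's bound along `g`**: `∑_{p ≤ t} ρ_g(p) log p ≤ C t` for all real `t ≥ 0`.
[folklore] -/
theorem thetaRoot_le {g : ℤ[X]} (hirr : Irreducible g) (hdeg : 0 < g.natDegree) :
    ∃ C : ℝ, 0 ≤ C ∧ ∀ t : ℝ, 0 ≤ t →
      ∑ p ∈ Nat.primesLE ⌊t⌋₊, (polyRootCountMod ![g] p : ℝ) * Real.log p ≤ C * t := by
  obtain ⟨C, hC0, hC⟩ := abs_thetaRoot_sub_self_le hirr hdeg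
  have hl2 : 0 < Real.log 2 := Real.log_pos one_lt_two
  refine ⟨1 + C / Real.log 2 ^ 2, by positivity, fun t ht => ?_⟩
  rcases lt_or_ge t 2 with ht2 | ht2
  · -- there are no primes `≤ ⌊t⌋₊ ≤ 1`
    have hfl : ⌊t⌋₊ < 2 := (Nat.floor_lt ht).mpr (by exact_mod_cast ht2)
    have hsum : ∑ p ∈ Nat.primesLE ⌊t⌋₊, (polyRootCountMod ![g] p : ℝ) * Real.log p = 0 := by
      refine sum_eq_zero fun p hp => ?_
      exfalso
      have h := Nat.mem_primesLE.mp hp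
      have := h.2.two_le.trans h.1
      omega
    rw [hsum]
    positivity
  · have hmain := hC t ht2
    have hlogt : Real.log 2 ≤ Real.log t := Real.log_le_log two_pos ht2
    have h1 : ∑ p ∈ Nat.primesLE ⌊t⌋₊, (polyRootCountMod ![g] p : ℝ) * Real.log p ≤
        t + C * t / Real.log t ^ 2 := by
      have := (abs_le.mp hmain).2
      linarith
    have h2 : C * t / Real.log t ^ 2 ≤ C * t / Real.log 2 ^ 2 :=
      div_le_div_of_nonneg_left (by positivity) (by positivity) (pow_le_pow_left₀ hl2.le hlogt 2)
    calc ∑ p ∈ Nat.primesLE ⌊t⌋₊, (polyRootCountMod ![g] p : ℝ) * Real.log p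
        ≤ t + C * t / Real.log t ^ 2 := h1
      _ ≤ t + C * t / Real.log 2 ^ 2 := by linarith
      _ = (1 + C / Real.log 2 ^ 2) * t := by ring

/-- **`ρ_g` on squarefree numbers**: `ρ_g(∏_{p ∈ t} p) = ∏_{p ∈ t} ρ_g(p)` for a finite set `t` of
primes (Chinese remainder theorem, `polyRootCountMod_mul_of_coprime`). [folklore] -/
theorem polyRootCountMod_prod_primes (g : ℤ[X]) {t : Finset ℕ} (ht : ∀ p ∈ t, p.Prime) :
    polyRootCountMod ![g] (∏ p ∈ t, p) = ∏ p ∈ t, polyRootCountMod ![g] p := by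
  induction t using Finset.induction_on with
  | empty => simp [polyRootCountMod]
  | @insert a s ha ih =>
    have hcop : a.Coprime (∏ p ∈ s, p) :=
      Nat.Coprime.prod_right fun p hp =>
        (Nat.coprime_primes (ht a (mem_insert_self a s)) (ht p (mem_insert_of_mem hp))).mpr
          fun h => ha (h ▸ hp)
    rw [prod_insert ha, prod_insert ha, polyRootCountMod_mul_of_coprime g hcop,
      ih fun p hp => ht p (mem_insert_of_mem hp)]

/-- **Squarefree harmonic sum of the root count**: `∑_{m ≤ V} μ(m)² ρ_g(m)/m ≤ K (1 + log V)` for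
every `V` (`≤ ∏_{p ≤ V} (1 + ρ_g(p)/p) ≤ exp(∑_{p ≤ V} ρ_g(p)/p)` and Mertens along `g`).
[folklore] -/
theorem sum_moebius_sq_rootCount_div_le {g : ℤ[X]} (hirr : Irreducible g)
    (hdeg : 0 < g.natDegree) :
    ∃ K : ℝ, 0 ≤ K ∧ ∀ V : ℕ,
      ∑ m ∈ Icc 1 V, (ArithmeticFunction.moebius m : ℝ) ^ 2 *
          (polyRootCountMod ![g] m : ℝ) / m ≤ K * (1 + Real.log V) := by
  obtain ⟨M, hM⟩ := exists_sum_polyRootCountMod_sub_one_div_le hirr hdeg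
  -- Mertens along `g`: `∑_{p ≤ V} ρ(p)/p ≤ log log V + (max M 0 + 4)` for `V ≥ 2`
  have hprime : ∀ V : ℕ, 2 ≤ V → ∑ p ∈ Nat.primesLE V, (polyRootCountMod ![g] p : ℝ) / p ≤
      Real.log (Real.log V) + (max M 0 + 4) := by
    intro V hV
    have h1 := hM V
    have h2 := MertensBound.sum_inv_prime_le V hV
    have hsplit : ∑ p ∈ Nat.primesLE V, (polyRootCountMod ![g] p : ℝ) / p =
        ∑ p ∈ Nat.primesLE V, ((polyRootCountMod ![g] p : ℝ) - 1) / p +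
          ∑ p ∈ Nat.primesLE V, (1 : ℝ) / p := by
      rw [← sum_add_distrib]
      refine sum_congr rfl fun p _ => ?_
      ring
    rw [hsplit]
    linarith [le_max_left M 0]
  -- the sum is at most `exp(∑_{p ≤ V} ρ(p)/p)`
  have hle_exp : ∀ V : ℕ, ∑ m ∈ Icc 1 V, (ArithmeticFunction.moebius m : ℝ) ^ 2 *
      (polyRootCountMod ![g] m : ℝ) / m ≤
        Real.exp (∑ p ∈ Nat.primesLE V, (polyRootCountMod ![g] p : ℝ) / p) := by
    intro V
    -- (i) only squarefree `m` contribute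
    have hsq : ∑ m ∈ Icc 1 V, (ArithmeticFunction.moebius m : ℝ) ^ 2 *
        (polyRootCountMod ![g] m : ℝ) / m =
          ∑ m ∈ (Icc 1 V).filter Squarefree, (polyRootCountMod ![g] m : ℝ) / m := by
      rw [sum_filter]
      refine sum_congr rfl fun m _ => ?_
      split_ifs with hm
      · rw [← Int.cast_pow, ArithmeticFunction.moebius_sq_eq_one_of_squarefree hm]
        push_cast
        ring
      · rw [ArithmeticFunction.moebius_eq_zero_of_not_squarefree hm]
        simp
    -- (ii) a squarefree term is the product over its prime factors
    have hterm : ∀ m ∈ (Icc 1 V).filter Squarefree, (polyRootCountMod ![g] m : ℝ) / m =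
        ∏ p ∈ m.primeFactors, (polyRootCountMod ![g] p : ℝ) / p := by
      intro m hm
      have hsqf : Squarefree m := (mem_filter.mp hm).2
      have hprod : ∏ p ∈ m.primeFactors, p = m := Nat.prod_primeFactors_of_squarefree hsqf
      have key : polyRootCountMod ![g] m = ∏ p ∈ m.primeFactors, polyRootCountMod ![g] p := by
        conv_lhs => rw [← hprod]
        exact polyRootCountMod_prod_primes g fun p hp => Nat.prime_of_mem_primeFactors hp
      have key2 : ((∏ p ∈ m.primeFactors, p : ℕ) : ℝ) = ∏ p ∈ m.primeFactors, (p : ℝ) :=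
        Nat.cast_prod _ _
      rw [prod_div_distrib, key, Nat.cast_prod, ← key2, hprod]
    -- (iii) `m ↦ primeFactors m` injects the squarefree `m ≤ V` into the subsets of `primesLE V`
    have hinj : Set.InjOn (fun m : ℕ => m.primeFactors)
        (((Icc 1 V).filter Squarefree : Finset ℕ) : Set ℕ) := by
      intro m₁ hm₁ m₂ hm₂ h
      have h₁ := Nat.prod_primeFactors_of_squarefree (mem_filter.mp hm₁).2
      have h₂ := Nat.prod_primeFactors_of_squarefree (mem_filter.mp hm₂).2
      simp only at h
      rw [← h₁, ← h₂, h]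
    have hsub : ((Icc 1 V).filter Squarefree).image (fun m : ℕ => m.primeFactors) ⊆
        (Nat.primesLE V).powerset := by
      intro t ht
      obtain ⟨m, hm, rfl⟩ := mem_image.mp ht
      have hmV : m ≤ V := (mem_Icc.mp (mem_filter.mp hm).1).2
      rw [mem_powerset]
      intro p hp
      exact Nat.mem_primesLE.mpr
        ⟨(Nat.le_of_mem_primeFactors hp).trans hmV, Nat.prime_of_mem_primeFactors hp⟩
    have hnn : ∀ p : ℕ, 0 ≤ (polyRootCountMod ![g] p : ℝ) / p := fun p => by positivity
    calc ∑ m ∈ Icc 1 V, (ArithmeticFunction.moebius m : ℝ) ^ 2 *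
          (polyRootCountMod ![g] m : ℝ) / m
        = ∑ m ∈ (Icc 1 V).filter Squarefree,
            ∏ p ∈ m.primeFactors, (polyRootCountMod ![g] p : ℝ) / p := by
          rw [hsq]
          exact sum_congr rfl hterm
      _ = ∑ t ∈ ((Icc 1 V).filter Squarefree).image (fun m : ℕ => m.primeFactors),
            ∏ p ∈ t, (polyRootCountMod ![g] p : ℝ) / p :=
          (sum_image (f := fun t => ∏ p ∈ t, (polyRootCountMod ![g] p : ℝ) / p) hinj).symm
      _ ≤ ∑ t ∈ (Nat.primesLE V).powerset, ∏ p ∈ t, (polyRootCountMod ![g] p : ℝ) / p :=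
          sum_le_sum_of_subset_of_nonneg hsub fun t _ _ => prod_nonneg fun p _ => hnn p
      _ = ∏ p ∈ Nat.primesLE V, (1 + (polyRootCountMod ![g] p : ℝ) / p) := (prod_one_add _).symm
      _ ≤ ∏ p ∈ Nat.primesLE V, Real.exp ((polyRootCountMod ![g] p : ℝ) / p) :=
          prod_le_prod (fun p _ => by positivity) fun p _ => by
            linarith [Real.add_one_le_exp ((polyRootCountMod ![g] p : ℝ) / p)]
      _ = Real.exp (∑ p ∈ Nat.primesLE V, (polyRootCountMod ![g] p : ℝ) / p) :=
          (Real.exp_sum _ _).symm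
  -- constants
  refine ⟨Real.exp (max M 0 + 4), (Real.exp_pos _).le, fun V => (hle_exp V).trans ?_⟩
  have hK1 : 1 ≤ Real.exp (max M 0 + 4) :=
    Real.one_le_exp (add_nonneg (le_max_right M 0) (by norm_num))
  have hlogV : 0 ≤ Real.log V := Real.log_natCast_nonneg V
  rcases lt_or_ge V 2 with hV | hV
  · have hempty : Nat.primesLE V = ∅ := by
      interval_cases V <;> simp
    rw [hempty, sum_empty, Real.exp_zero]
    have := mul_nonneg (zero_le_one.trans hK1) hlogV
    linarith
  · have hV' : (1 : ℝ) < V := by exact_mod_cast hV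
    have hlogpos : 0 < Real.log V := Real.log_pos hV'
    calc Real.exp (∑ p ∈ Nat.primesLE V, (polyRootCountMod ![g] p : ℝ) / p)
        ≤ Real.exp (Real.log (Real.log V) + (max M 0 + 4)) := Real.exp_le_exp.mpr (hprime V hV)
      _ = Real.log V * Real.exp (max M 0 + 4) := by
          rw [Real.exp_add, Real.exp_log hlogpos]
      _ ≤ Real.exp (max M 0 + 4) * (1 + Real.log V) := by
          nlinarith [Real.exp_pos (max M 0 + 4)]

end Literature.NumberTheory.LFunctions.DegreeOnePrimes

end
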